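import Summits.CriticalPhenomena.PercolationContinuityZ3.Theorems.PercNearOneGluingNoHeavyQuantBlobAverageFloor
import HarnessLib

/-!
# QUANT lane R8, T-DEC: TWO BLOBS ARE HEAVY-DEC AT THEIR AVERAGE GATE, and the lift `ρ ∗ gate_c ρ` (one sure glued sibling beside a
# gated copy) is DEC at floor `(1+c)g/2` — every shape `(r, k)` (prim-quant-census-2 gen 80)

builds on p205010 (kernel theorem, internal audit signed; external expert review pending)

Support file (`--supports stmt-CriticalPhenomena-4575`), QUANT lane census seat prim-quant-census-2 (gen 80); memo
`run/shared/lean/prim/quant/prim-quant-census-2-g80/TRIPLE-G80.md` §6.  Theorems only, standard axioms, no sorries, no definitions.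
The width-2 member of the family `…QuantBlobAverageFloor` (three blobs) / `…QuantFourBlobAverageFloor` (four blobs).

* **`heavy_threeAtoms_r1` / `heavy_threeAtoms_r2`** — an abstract three-atom law `p₀δ₀ + p₁δ_k + p₂δ_{2k}` (`pᵢ ≥ 0`, `Σ = 1`, `p₁ + 2p₂ = s > 0`)
  has a HEAVY decomposition (`…QuantHeavyShift`) at floor `s/2`, target `s·k`: for `s ≤ 1` exactly (the zero ships to `k`, `2k` at the credit gates
  `s`, `s/2`); for `1 < s < 2` (`k` stands alone, the zero ships to `2k` at gate `s/2`) given the one capacity inequality `s·p₀ ≤ (2−s)·p₂`.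
* **`heavy_twoBlobs`** — the law of `k·(ξ + ζ)`, `ξ ~ Bernoulli(g)`, `ζ ~ Bernoulli(cg)`: `(1−c)·[k·Bin(1,g)] + c·[k·Bin(2,g)]`, weights
  `p₀ = (1−g)(1−cg)`, `p₁ = g(1+c−2cg)`, `p₂ = cg²`, mean `s = (1+c)g`, is heavy-DEC at floor `s/2` = the AVERAGE gate, target `s·k`; the capacity
  inequality is the identity `(2−s)p₂ − s·p₀ = g(s−1)(1+c−2cg)` (tight at `s = 1`).
* **`decAtT_oneSureOneGated`** — `X₁ = ρ ∗ gate_c ρ`, `ρ = blobLaw [(k,g),(r,1)]`, is `DECAtT ((1+c)g/2) ((1+c)(r+kg)) j (2(r+k))` at EVERY layer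
  `j`, every shape: two blobs at the average gate, the gated copy's atoms moved up by `r` (`heavy_shift_partial`), everything by `r`
  (`heavy_shift_full`, target `+2r ≥ (1+c)r`).  This is g79's lift fact (I) (`GLUEDPAIR-G79 §9`) at OUTER GATE 1 in `DECAtT` form; USE: the
  polarized component of the NON-identical glued pair at its average floor (`…QuantGluedTwoGates`).

HONEST STATUS.  `SiblingStep`, `FarTreeRow` OPEN; RATE class (log\*) / honest sentence of `run/shared/lean/prim/quant/README.md` unchanged.
[this work].  Nothing here is cited as a published result.  The gluing rows served [cite: KozmaNitzan2024, Conjecture 3 (p. 15)]; product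
measure [cite: Grimmett1999, §1.3 p. 10].
-/

noncomputable section

open scoped BigOperators

namespace Summit.CriticalPhenomena.PercolationContinuityZ3.Theorems
namespace Quant

open Finset

/-- the two-point law `{lo, hi; g}` (as in `…QuantLawDEC`) -/
local notation3 "TP[" lo ", " hi ", " g ", " h "]" =>
  (g : ℝ) * (if (h : ℕ) = (hi : ℕ) then (1 : ℝ) else 0) + (1 - (g : ℝ)) * (if (h : ℕ) = (lo : ℕ) then (1 : ℝ) else 0)

namespace LawDec

/-! ### Three atoms `0, k, 2k` at floor `s/2` -/

/-- regime `s ≤ 1`: the zero ships to `k`, `2k` at the credit gates `s`, `s/2` — exactly (`p₁ + 2p₂ = s`). [this work] -/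
theorem heavy_threeAtoms_r1 (k : ℕ) (p₀ p₁ p₂ s : ℝ) (hp₁0 : 0 ≤ p₁) (hp₂0 : 0 ≤ p₂) (hsum : p₀ + p₁ + p₂ = 1)
    (hmean : p₁ + 2 * p₂ = s) (hs0 : 0 < s) (h1 : s ≤ 1) :
    ∃ (ι : Type) (_ : Fintype ι) (lam γ : ι → ℝ) (lo hi : ι → ℕ),
      (∀ i, 0 ≤ lam i) ∧ (∑ i, lam i = 1) ∧ (∀ i, 0 ≤ γ i ∧ γ i ≤ 1) ∧ (∀ i, lo i ≤ hi i) ∧ (∀ i, hi i ≤ 2 * k) ∧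
      (∀ h, (p₀ * (if h = 0 then (1 : ℝ) else 0) + p₁ * (if h = k then (1 : ℝ) else 0) + p₂ * (if h = 2 * k then (1 : ℝ) else 0))
          = ∑ i, lam i * TP[lo i, hi i, γ i, h]) ∧
      (∀ i, 0 < lam i → s / 2 ≤ γ i ∧ s * k ≤ 2 * (lo i : ℝ) + ((hi i : ℝ) - lo i) * γ i) := by
  have hk0 : (0 : ℝ) ≤ k := Nat.cast_nonneg k
  have c2k : ((2 * k : ℕ) : ℝ) = 2 * (k : ℝ) := by push_cast; ring
  have hγ₂0 : 0 < s / 2 := by positivity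
  refine ⟨Fin 2, inferInstance, ![p₁ / s, p₂ / (s / 2)], ![s, s / 2], ![0, 0], ![k, 2 * k], ?_, ?_, ?_, ?_, ?_, fun h => ?_, ?_⟩
  · intro i; fin_cases i
    · exact div_nonneg hp₁0 hs0.le
    · exact div_nonneg hp₂0 hγ₂0.le
  · rw [Fin.sum_univ_two]
    show p₁ / s + p₂ / (s / 2) = 1
    have e : p₁ / s + p₂ / (s / 2) = (p₁ + 2 * p₂) / s := by
      field_simp
    rw [e, hmean, div_self hs0.ne']
  · intro i; fin_cases i
    · exact ⟨hs0.le, h1⟩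
    · exact ⟨hγ₂0.le, by show s / 2 ≤ 1; linarith⟩
  · intro i; fin_cases i <;> exact Nat.zero_le _
  · intro i; fin_cases i
    · show k ≤ 2 * k; omega
    · exact le_rfl
  · rw [Fin.sum_univ_two]
    show _ = p₁ / s * TP[0, k, s, h] + p₂ / (s / 2) * TP[0, 2 * k, s / 2, h]
    have e1 : p₁ / s * s = p₁ := div_mul_cancel₀ p₁ hs0.ne'
    have e2 : p₂ / (s / 2) * (s / 2) = p₂ := div_mul_cancel₀ p₂ hγ₂0.ne'
    have e0 : p₁ / s * (1 - s) + p₂ / (s / 2) * (1 - s / 2) = p₀ := by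
      have : p₁ / s * (1 - s) + p₂ / (s / 2) * (1 - s / 2) = (p₁ + 2 * p₂) / s - (p₁ + p₂) := by field_simp; ring
      rw [this, hmean, div_self hs0.ne']; linarith
    linear_combination (-(if h = k then (1 : ℝ) else 0)) * e1 - (if h = 2 * k then (1 : ℝ) else 0) * e2
      - (if h = 0 then (1 : ℝ) else 0) * e0
  · intro i hi
    clear hi
    fin_cases i
    · show s / 2 ≤ s ∧ s * k ≤ 2 * ((0 : ℕ) : ℝ) + ((k : ℝ) - ((0 : ℕ) : ℝ)) * s
      push_cast
      exact ⟨by linarith, by linarith⟩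
    · show s / 2 ≤ s / 2 ∧ s * k ≤ 2 * ((0 : ℕ) : ℝ) + (((2 * k : ℕ) : ℝ) - ((0 : ℕ) : ℝ)) * (s / 2)
      rw [c2k]; push_cast
      exact ⟨le_rfl, by linarith⟩

/-- regime `s < 2` (used for `1 < s`): `k` stands alone; the zero ships to `2k` at the floor gate `s/2`, given the capacity inequality
`s·p₀ ≤ (2−s)·p₂`. [this work] -/
theorem heavy_threeAtoms_r2 (k : ℕ) (p₀ p₁ p₂ s : ℝ) (hp₀0 : 0 ≤ p₀) (hp₁0 : 0 ≤ p₁) (hsum : p₀ + p₁ + p₂ = 1)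
    (hs0 : 0 < s) (h2 : s < 2) (hZ : s * p₀ ≤ (2 - s) * p₂) :
    ∃ (ι : Type) (_ : Fintype ι) (lam γ : ι → ℝ) (lo hi : ι → ℕ),
      (∀ i, 0 ≤ lam i) ∧ (∑ i, lam i = 1) ∧ (∀ i, 0 ≤ γ i ∧ γ i ≤ 1) ∧ (∀ i, lo i ≤ hi i) ∧ (∀ i, hi i ≤ 2 * k) ∧
      (∀ h, (p₀ * (if h = 0 then (1 : ℝ) else 0) + p₁ * (if h = k then (1 : ℝ) else 0) + p₂ * (if h = 2 * k then (1 : ℝ) else 0))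
          = ∑ i, lam i * TP[lo i, hi i, γ i, h]) ∧
      (∀ i, 0 < lam i → s / 2 ≤ γ i ∧ s * k ≤ 2 * (lo i : ℝ) + ((hi i : ℝ) - lo i) * γ i) := by
  have hk0 : (0 : ℝ) ≤ k := Nat.cast_nonneg k
  have c2k : ((2 * k : ℕ) : ℝ) = 2 * (k : ℝ) := by push_cast; ring
  obtain ⟨x, hx⟩ : ∃ x : ℝ, x = s / 2 := ⟨_, rfl⟩
  have hx0 : 0 < x := by rw [hx]; positivity
  have hx1 : x < 1 := by rw [hx]; linarith
  -- the pair `{0, 2k; x}` of weight `l₀ = p₀/(1−x)` and the leftover point at `2k`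
  obtain ⟨l₀, hl₀⟩ : ∃ l : ℝ, l = p₀ / (1 - x) := ⟨_, rfl⟩
  have h1x : 1 - x ≠ 0 := ne_of_gt (by linarith)
  have hl₀0 : 0 ≤ l₀ := by rw [hl₀]; exact div_nonneg hp₀0 (by linarith)
  have e0 : l₀ * (1 - x) = p₀ := by rw [hl₀]; exact div_mul_cancel₀ p₀ h1x
  have hcap : l₀ * x ≤ p₂ := by
    have h' : l₀ * x * (2 * (1 - x)) ≤ p₂ * (2 * (1 - x)) := by
      have e : l₀ * x * (2 * (1 - x)) = s * p₀ := by
        rw [show l₀ * x * (2 * (1 - x)) = (l₀ * (1 - x)) * (2 * x) by ring, e0, hx]; ring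
      rw [e]
      have e' : p₂ * (2 * (1 - x)) = (2 - s) * p₂ := by rw [hx]; ring
      rw [e']; exact hZ
    exact le_of_mul_le_mul_right h' (by linarith)
  have hsk2 : s * (k : ℝ) ≤ 2 * k := by nlinarith
  refine ⟨Fin 3, inferInstance, ![l₀, p₁, p₂ - l₀ * x], ![x, 1, 1], ![0, k, 2 * k], ![2 * k, k, 2 * k],
    ?_, ?_, ?_, ?_, ?_, fun h => ?_, ?_⟩
  · intro i; fin_cases i
    · exact hl₀0
    · exact hp₁0
    · show 0 ≤ p₂ - l₀ * x; linarith
  · rw [Fin.sum_univ_three]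
    show l₀ + p₁ + (p₂ - l₀ * x) = 1
    linear_combination e0 + hsum
  · intro i; fin_cases i
    · exact ⟨hx0.le, hx1.le⟩
    · exact ⟨zero_le_one, le_rfl⟩
    · exact ⟨zero_le_one, le_rfl⟩
  · intro i; fin_cases i
    · exact Nat.zero_le _
    · exact le_rfl
    · exact le_rfl
  · intro i; fin_cases i
    · exact le_rfl
    · show k ≤ 2 * k; omega
    · exact le_rfl
  · rw [Fin.sum_univ_three]
    show _ = l₀ * TP[0, 2 * k, x, h] + p₁ * TP[k, k, (1 : ℝ), h] + (p₂ - l₀ * x) * TP[2 * k, 2 * k, (1 : ℝ), h]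
    linear_combination (-(if h = 0 then (1 : ℝ) else 0)) * e0
  · intro i hi
    clear hi
    fin_cases i
    · show s / 2 ≤ x ∧ s * k ≤ 2 * ((0 : ℕ) : ℝ) + (((2 * k : ℕ) : ℝ) - ((0 : ℕ) : ℝ)) * x
      rw [c2k, hx]; push_cast
      exact ⟨le_rfl, by linarith⟩
    · show s / 2 ≤ 1 ∧ s * k ≤ 2 * (k : ℝ) + ((k : ℝ) - k) * 1
      exact ⟨by linarith, by linarith⟩
    · show s / 2 ≤ 1 ∧ s * k ≤ 2 * ((2 * k : ℕ) : ℝ) + (((2 * k : ℕ) : ℝ) - ((2 * k : ℕ) : ℝ)) * 1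
      rw [c2k]
      exact ⟨by linarith, by linarith⟩

/-! ### Two blobs at the average gate -/

/-- the capacity inequality of the two-blob weights for `s = (1+c)g > 1`: `s·p₀ ≤ (2−s)·p₂` — an identity,
`(2−s)p₂ − s·p₀ = g(s−1)(1+c−2cg)`. [this work] -/
theorem twoBlobs_hZ {c g : ℝ} (hc0 : 0 < c) (hc1 : c ≤ 1) (hg0 : 0 < g) (hg1 : g < 1) (hs : 1 < (1 + c) * g) :
    (1 + c) * g * ((1 - g) * (1 - c * g)) ≤ (2 - (1 + c) * g) * (c * g ^ 2) := by
  have hcg : c * g ≤ c := by nlinarith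
  have e : (2 - (1 + c) * g) * (c * g ^ 2) - (1 + c) * g * ((1 - g) * (1 - c * g)) = g * ((1 + c) * g - 1) * (1 + c - 2 * c * g) := by
    ring
  have h0 : 0 ≤ g * ((1 + c) * g - 1) * (1 + c - 2 * c * g) := mul_nonneg (mul_nonneg hg0.le (by linarith)) (by linarith)
  linarith

/-- **TWO BLOBS ARE HEAVY-DEC AT THEIR AVERAGE GATE.**  For `0 < g < 1`, `0 < c ≤ 1` and a blob size `k`, the law
`(1−c)·[k·Bin(1,g)] + c·[k·Bin(2,g)]` (two independent blobs of size `k` with gates `g, cg`) on `{0, k, 2k}` is an exact mixture of components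
`{lo, hi; γ}` with `γ ≥ (1+c)g/2` and credit `2lo + (hi−lo)γ ≥ (1+c)g·k` (its mean). [this work] -/
theorem heavy_twoBlobs (k : ℕ) {g c : ℝ} (hg0 : 0 < g) (hg1 : g < 1) (hc0 : 0 < c) (hc1 : c ≤ 1) :
    ∃ (ι : Type) (_ : Fintype ι) (lam γ : ι → ℝ) (lo hi : ι → ℕ),
      (∀ i, 0 ≤ lam i) ∧ (∑ i, lam i = 1) ∧ (∀ i, 0 ≤ γ i ∧ γ i ≤ 1) ∧ (∀ i, lo i ≤ hi i) ∧ (∀ i, hi i ≤ 2 * k) ∧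
      (∀ h, ((1 - c) * ((1 - g) * (if h = 0 then (1 : ℝ) else 0) + g * (if h = k then (1 : ℝ) else 0))
            + c * ((1 - g) ^ 2 * (if h = 0 then (1 : ℝ) else 0) + 2 * g * (1 - g) * (if h = k then (1 : ℝ) else 0)
                + g ^ 2 * (if h = 2 * k then (1 : ℝ) else 0)))
          = ∑ i, lam i * TP[lo i, hi i, γ i, h]) ∧
      (∀ i, 0 < lam i → (1 + c) * g / 2 ≤ γ i ∧ (1 + c) * g * k ≤ 2 * (lo i : ℝ) + ((hi i : ℝ) - lo i) * γ i) := by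
  have h1g : 0 < 1 - g := by linarith
  have hcg1 : c * g < 1 := by nlinarith
  have hcg : c * g ≤ c := by nlinarith
  have hp₀0 : (0 : ℝ) ≤ (1 - g) * (1 - c * g) := mul_nonneg h1g.le (by linarith)
  have hp₁0 : (0 : ℝ) ≤ g * (1 + c - 2 * c * g) := mul_nonneg hg0.le (by linarith)
  have hsum : (1 - g) * (1 - c * g) + g * (1 + c - 2 * c * g) + c * g ^ 2 = 1 := by ring
  have hmean : g * (1 + c - 2 * c * g) + 2 * (c * g ^ 2) = (1 + c) * g := by ring
  have hs0 : 0 < (1 + c) * g := by positivity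
  have hlaw : ∀ h : ℕ, ((1 - c) * ((1 - g) * (if h = 0 then (1 : ℝ) else 0) + g * (if h = k then (1 : ℝ) else 0))
            + c * ((1 - g) ^ 2 * (if h = 0 then (1 : ℝ) else 0) + 2 * g * (1 - g) * (if h = k then (1 : ℝ) else 0)
                + g ^ 2 * (if h = 2 * k then (1 : ℝ) else 0)))
      = (1 - g) * (1 - c * g) * (if h = 0 then (1 : ℝ) else 0) + g * (1 + c - 2 * c * g) * (if h = k then (1 : ℝ) else 0)
        + c * g ^ 2 * (if h = 2 * k then (1 : ℝ) else 0) :=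
    fun h => by ring
  have main : ∃ (ι : Type) (_ : Fintype ι) (lam γ : ι → ℝ) (lo hi : ι → ℕ),
      (∀ i, 0 ≤ lam i) ∧ (∑ i, lam i = 1) ∧ (∀ i, 0 ≤ γ i ∧ γ i ≤ 1) ∧ (∀ i, lo i ≤ hi i) ∧ (∀ i, hi i ≤ 2 * k) ∧
      (∀ h, ((1 - g) * (1 - c * g) * (if h = 0 then (1 : ℝ) else 0) + g * (1 + c - 2 * c * g) * (if h = k then (1 : ℝ) else 0)
          + c * g ^ 2 * (if h = 2 * k then (1 : ℝ) else 0))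
          = ∑ i, lam i * TP[lo i, hi i, γ i, h]) ∧
      (∀ i, 0 < lam i → (1 + c) * g / 2 ≤ γ i ∧ (1 + c) * g * k ≤ 2 * (lo i : ℝ) + ((hi i : ℝ) - lo i) * γ i) := by
    rcases le_or_gt ((1 + c) * g) 1 with h1 | h1
    · exact heavy_threeAtoms_r1 k _ _ _ _ hp₁0 (by positivity) hsum hmean hs0 h1
    · have h2 : (1 + c) * g < 2 := by nlinarith
      exact heavy_threeAtoms_r2 k _ _ _ _ hp₀0 hp₁0 hsum hs0 h2 (twoBlobs_hZ hc0 hc1 hg0 hg1 h1)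
  obtain ⟨ι, hι, lam, γ, lo, hi, h0, h1, hγ, hlohi, hhi, hμ, hval⟩ := main
  exact ⟨ι, hι, lam, γ, lo, hi, h0, h1, hγ, hlohi, hhi, fun h => (hlaw h).trans (hμ h), hval⟩

/-! ### The lift `ρ ∗ gate_c ρ` atom by atom, and at floor `(1+c)g/2` -/

/-- **`X₁ = ρ ∗ gate_c ρ` atom by atom**: `(1−c)·ρ + c·(ρ ∗ ρ)`. [this work] -/
theorem oneSureOneGated_apply (r k : ℕ) (g c : ℝ) (h : ℕ) :
    lconv (r + k) (r + k) (blobLaw [(k, g), (r, 1)]) (gate (blobLaw [(k, g), (r, 1)]) c) h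
      = (1 - c) * ((1 - g) * pointLaw r h + g * pointLaw (r + k) h)
        + c * ((1 - g) ^ 2 * pointLaw (2 * r) h + 2 * g * (1 - g) * pointLaw (2 * r + k) h + g ^ 2 * pointLaw (2 * r + 2 * k) h) := by
  have hρM : ∀ t, r + k < t → blobLaw [(k, g), (r, 1)] t = 0 := fun t ht => by
    rw [blobLaw_pair_sure_apply]; simp only [pointLaw_apply]; rw [if_neg (by omega), if_neg (by omega)]; ring
  rw [lconv_gate_right _ _ _ _ _ hρM h, glued_sq_apply, blobLaw_pair_sure_apply, Nat.add_comm k r]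
  ring

/-- **the same law as the shifted blob law**: `X₁ h = [r ≤ h]·( (1−c)B₁(h−r) + [r ≤ h−r]·c·B₂(h−2r) )`, `B₁ = k·Bin(1,g)`, `B₂ = k·Bin(2,g)` on the
atoms `0, k, 2k`. [this work] -/
theorem oneSureOneGated_eq_shift (r k : ℕ) (g c : ℝ) (h : ℕ) :
    lconv (r + k) (r + k) (blobLaw [(k, g), (r, 1)]) (gate (blobLaw [(k, g), (r, 1)]) c) h
      = (if r ≤ h then
          ((fun t => (1 - c) * ((1 - g) * (if t = 0 then (1 : ℝ) else 0) + g * (if t = k then (1 : ℝ) else 0))) (h - r)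
            + (if r ≤ h - r then
                (fun t => c * ((1 - g) ^ 2 * (if t = 0 then (1 : ℝ) else 0) + 2 * g * (1 - g) * (if t = k then (1 : ℝ) else 0)
                  + g ^ 2 * (if t = 2 * k then (1 : ℝ) else 0))) (h - r - r)
              else 0))
        else 0) := by
  rw [oneSureOneGated_apply]
  simp only [pointLaw]
  by_cases h1 : r ≤ h
  · rw [if_pos h1]
    rw [ind_sub h1 0, ind_sub h1 k, show r + 0 = r by ring]
    by_cases h2 : r ≤ h - r
    · rw [if_pos h2]
      have h2' : r + r ≤ h := by omega
      have esub : h - r - r = h - (r + r) := by omega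
      rw [esub, ind_sub h2' 0, ind_sub h2' k, ind_sub h2' (2 * k), show r + r + 0 = 2 * r by ring, show r + r + k = 2 * r + k by ring,
        show r + r + 2 * k = 2 * r + 2 * k by ring]
    · rw [if_neg h2, if_neg (show ¬ (h = 2 * r) by omega), if_neg (show ¬ (h = 2 * r + k) by omega),
        if_neg (show ¬ (h = 2 * r + 2 * k) by omega)]
      ring
  · rw [if_neg h1, if_neg (show ¬ (h = r) by omega), if_neg (show ¬ (h = r + k) by omega), if_neg (show ¬ (h = 2 * r) by omega),
      if_neg (show ¬ (h = 2 * r + k) by omega), if_neg (show ¬ (h = 2 * r + 2 * k) by omega)]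
    ring

/-- **THE LIFT `ρ ∗ gate_c ρ` AT FLOOR `(1+c)g/2`** (a sure glued sibling `ρ = blobLaw [(k,g),(r,1)]` beside a `c`-gated copy).  For `0 < g < 1`,
`0 < c ≤ 1`, every layer `j`: `DECAtT ((1+c)g/2) ((1+c)(r+kg)) j (2(r+k)) (ρ ∗ gate_c ρ)` — DEC at its own mean at the AVERAGE floor, above the
natural floor `c·g`, for every shape `(r, k)`. [this work] -/
theorem decAtT_oneSureOneGated (r k : ℕ) {g c : ℝ} (hg0 : 0 < g) (hg1 : g < 1) (hc0 : 0 < c) (hc1 : c ≤ 1) (j : ℕ) :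
    DECAtT ((1 + c) * g / 2) ((1 + c) * ((r : ℝ) + k * g)) j ((r + k) + (r + k))
      (lconv (r + k) (r + k) (blobLaw [(k, g), (r, 1)]) (gate (blobLaw [(k, g), (r, 1)]) c)) := by
  have hx1 : (1 + c) * g / 2 ≤ 1 := by nlinarith
  have h1g : 0 ≤ 1 - g := by linarith
  have hB := heavy_twoBlobs k hg0 hg1 hc0 hc1
  have hind : ∀ t a : ℕ, (0 : ℝ) ≤ (if t = a then (1 : ℝ) else 0) := fun t a => by split_ifs <;> norm_num
  have hP := heavy_shift_partial ((1 + c) * g / 2) ((1 + c) * g * k) (2 * k) r _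
    (fun t => (1 - c) * ((1 - g) * (if t = 0 then (1 : ℝ) else 0) + g * (if t = k then (1 : ℝ) else 0)))
    (fun t => c * ((1 - g) ^ 2 * (if t = 0 then (1 : ℝ) else 0) + 2 * g * (1 - g) * (if t = k then (1 : ℝ) else 0)
      + g ^ 2 * (if t = 2 * k then (1 : ℝ) else 0)))
    hx1 (fun t => rfl)
    (fun t => mul_nonneg (by linarith) (add_nonneg (mul_nonneg h1g (hind t 0)) (mul_nonneg hg0.le (hind t k))))
    (fun t => mul_nonneg hc0.le (add_nonneg (add_nonneg (mul_nonneg (sq_nonneg _) (hind t 0))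
      (mul_nonneg (mul_nonneg (by linarith) h1g) (hind t k))) (mul_nonneg (sq_nonneg _) (hind t (2 * k)))))
    hB
  have hF := heavy_shift_full ((1 + c) * g / 2) ((1 + c) * g * k) (2 * k + r) r _ hP
  have hD := decAtT_of_heavy ((1 + c) * g / 2) ((1 + c) * g * k + 2 * ((r : ℕ) : ℝ)) (2 * k + r + r) _ hF j
  have e : (fun h : ℕ => if r ≤ h then
          ((fun t => (1 - c) * ((1 - g) * (if t = 0 then (1 : ℝ) else 0) + g * (if t = k then (1 : ℝ) else 0))) (h - r)
            + (if r ≤ h - r then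
                (fun t => c * ((1 - g) ^ 2 * (if t = 0 then (1 : ℝ) else 0) + 2 * g * (1 - g) * (if t = k then (1 : ℝ) else 0)
                  + g ^ 2 * (if t = 2 * k then (1 : ℝ) else 0))) (h - r - r)
              else 0))
        else 0)
      = lconv (r + k) (r + k) (blobLaw [(k, g), (r, 1)]) (gate (blobLaw [(k, g), (r, 1)]) c) :=
    funext fun h => (oneSureOneGated_eq_shift r k g c h).symm
  rw [e] at hD
  have hT : (1 + c) * ((r : ℝ) + k * g) ≤ (1 + c) * g * k + 2 * ((r : ℕ) : ℝ) := by
    have hr0 : (0 : ℝ) ≤ r := Nat.cast_nonneg r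
    nlinarith [mul_nonneg hr0 (by linarith : (0 : ℝ) ≤ 1 - c)]
  have hM : 2 * k + r + r ≤ (r + k) + (r + k) := by omega
  exact decAtT_mono_top (decAtT_antitone_target hT hD) hM

end LawDec
end Quant
end Summit.CriticalPhenomena.PercolationContinuityZ3.Theorems
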